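import Literature.Barriers.NavierStokesRegularity.NavierStokesInequalitySwitching
import Literature.Barriers.NavierStokesRegularity.NavierStokesInequalitySingularSolutionsProofs
import HarnessLib

/-!
# Scheffer's singular NSI solution: bridge between the two historical decompositions (deprecated shim)

Barrier catalogue support file for `NavierStokesRegularity` (D-0021); kept only so that two old
names still resolve. History: the named fact
`Literature.Barriers.NavierStokesRegularity.NavierStokesInequalitySingularSolution` (Scheffer 1985,
Thm. 1.1, in the form of Ożański 2020, Thm. 1.5) was at one point decomposed in the tree TWICE
along the same printed architecture (Ożański 2017, arXiv:1709.00602, §2: switching argument (A) +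
existence of a classical NSI block with interior gain of magnitude (B)):

* `NavierStokesInequalitySwitching.lean` — PUBLIC structure `IsNSIBlock`, facts `NSISwitching` (A)
  and `NSIBlockExists` (B), proved assembly
  `navierStokesInequalitySingularSolution_of_switching : NSISwitching → NSIBlockExists → …`;
* `NavierStokesInequalitySingularSolutionsProofs.lean` — originally a module-PRIVATE copy of the
  block structure with facts `IsNSIBlock.switching` (A') and `exists_isNSIBlock` (B') over it.

This file bridged the two copies (B' ⇒ B, A ⇒ A', and the mixed assembly A + B' ⇒ barrier).
The private copy has since been removed: `IsNSIBlock.switching` and `exists_isNSIBlock` are now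
`abbrev`s of `NSISwitching` and `NSIBlockExists` (see "History of this file" in
`NavierStokesInequalitySingularSolutionsProofs.lean`). Consequently both bridge implications are
the identity map — they are kept below, DEPRECATED, with unchanged statements — and the former
mixed assembly `navierStokesInequalitySingularSolution_of_nsiSwitching_of_exists_isNSIBlock :
NSISwitching → exists_isNSIBlock → NavierStokesInequalitySingularSolution` was literally the
accepted public assembly `navierStokesInequalitySingularSolution_of_switching`; it has been
removed as a duplicate (use `navierStokesInequalitySingularSolution_of_switching hA hB`, which
type-checks verbatim for `hB : exists_isNSIBlock`). No other `Literature` module imports this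
file. Nothing is asserted; no definitions.

## References

* W. S. Ożański, *On weak solutions to the Navier–Stokes inequality with internal
  singularities*, arXiv:1709.00602 (2017), §2 (p. 7: "Therefore we have established the proof of
  Theorem 1 given the existence of `T, G, u, ν₀, τ` and `z` …"), §4 Prop. 9. [`Ozanski2017NSISingular`]
* V. Scheffer, *A solution to the Navier–Stokes inequality with an internal singularity*,
  Comm. Math. Phys. 101 (1985), 47–85: Thm. 1.1, Lemmas 2.3–2.4, p. 84. [`Scheffer1985`]
-/

noncomputable section

namespace Literature.Barriers.NavierStokesRegularity

/-- **(B' ⇒ B)**, now the identity map: `exists_isNSIBlock` (Ożański 2017, §4 Prop. 9 with §5)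
is an `abbrev` of `NSIBlockExists`, so a hypothesis `h : exists_isNSIBlock` can be used wherever
`NSIBlockExists` is expected. Deprecated; kept so the old name resolves.
[cite: Ozanski2017NSISingular, §2 and §4 Prop. 9] -/
@[deprecated "`exists_isNSIBlock` is an `abbrev` of `NSIBlockExists`: use the hypothesis itself"
  (since := "2026-08-15")]
theorem nsiBlockExists_of_exists_isNSIBlock (h : exists_isNSIBlock) : NSIBlockExists :=
  h

/-- **(A ⇒ A')**, now the identity map: `IsNSIBlock.switching` (the switching argument, Ożański
2017, §2; Scheffer 1985, Lemma 2.3) is an `abbrev` of `NSISwitching`, so a hypothesis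
`hA : NSISwitching` can be used wherever `IsNSIBlock.switching` is expected. Deprecated; kept so
the old name resolves. [cite: Ozanski2017NSISingular, §2] -/
@[deprecated "`IsNSIBlock.switching` is an `abbrev` of `NSISwitching`: use the hypothesis itself"
  (since := "2026-08-15")]
theorem isNSIBlock_switching_of_nsiSwitching (hA : NSISwitching) : IsNSIBlock.switching :=
  hA

end Literature.Barriers.NavierStokesRegularity

end
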